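import Mathlib
import Summits.ValiantsHypothesis.ValiantsHypothesis.Theorems.RigidityForcesSymmetryRankRigidMinimalReprLaplaceResidualCase1Hubs

/-!
# `LaplaceOptimalFive`, residual configurations: CASE 1 with the full-support covector at any slice slot (configuration (0; 01,02,34), hubs 1 and 2)
# (crux `RankRigidMinimalRepr`, stmt-ValiantsHypothesis-18034; frontier rung `LaplaceOptimalFive`, stmt-24813)

CASE 1 of the blueprint (evidence note NOTE-p8g11-24813 §v3) for the four residual sorted labelled configurations of
`laplace_five_three_slices_residual`, with the hub (the slice slot whose vector admits an orthogonal covector with all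
coordinates non-zero) at an ARBITRARY slice slot: the same dual-witness construction as `triangle_case1` / `outside_case1`
(`…LaplaceResidualCase1.lean`) — hub covector `φ₀`, support-three covector `φ₁` at a slot adjacent to the hub through a cut,
two independent candidates at the third slice slot, LEMMA Z + the `2 × 2` core for injectivity, LEMMA C for the last two
slots — with the fibre sums re-ordered to the roles by `fibre_sum_perm3`.  Statements in the normal-form format of the
residual hypothesis `hres`.  `outside_case1_hub1`, `outside_case1_hub2`.

HONEST FRAMING: exact partial results toward the frontier rung `LaplaceOptimalFive` (stmt-24813), which stays OPEN (CASE 2 —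
all three slice vectors letter indicators — remains); nothing here bears on `VP ≠ VNP`.
-/

set_option autoImplicit false

-- the mandated summit-side namespace repeats a component by design (single-problem summit)
set_option linter.dupNamespace false

namespace Summit.ValiantsHypothesis.ValiantsHypothesis.Theorems.RigidityForcesSymmetryRankRigidMinimalRepr

namespace LaplaceResidual

open Finset

/-- Configuration `(0; 01, 02, 34)`, CASE 1 with the hub at slot `1`. -/
theorem outside_case1_hub1 (α : Fin 3 → Fin 5 → ℂ) (W : Fin 3 → (Fin 5 → Fin 5) → ℂ)
    (hW : ∀ k, ∀ v v' : Fin 5 → Fin 5, (∀ j, j ≠ (![0, 1, 2] : Fin 3 → Fin 5) k → v j = v' j) → W k v = W k v')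
    (u w : Fin 3 → (Fin 5 → Fin 5) → ℂ)
    (hu : ∀ t, ∀ v v' : Fin 5 → Fin 5, v ((![0, 0, 3] : Fin 3 → Fin 5) t) = v' ((![0, 0, 3] : Fin 3 → Fin 5) t) →
      v ((![1, 2, 4] : Fin 3 → Fin 5) t) = v' ((![1, 2, 4] : Fin 3 → Fin 5) t) → u t v = u t v')
    (hw : ∀ t, ∀ v v' : Fin 5 → Fin 5, (∀ j, j ≠ (![0, 0, 3] : Fin 3 → Fin 5) t →
      j ≠ (![1, 2, 4] : Fin 3 → Fin 5) t → v j = v' j) → w t v = w t v')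
    (hfull : ∃ φ₀ : Fin 5 → ℂ, (∀ c, φ₀ c ≠ 0) ∧ ∑ c, φ₀ c * α 1 c = 0) :
    ¬ ∀ v : Fin 5 → Fin 5, (if Function.Injective v then (1 : ℂ) else 0) =
      (∑ k, α k (v ((![0, 1, 2] : Fin 3 → Fin 5) k)) * W k v) + ∑ t, u t v * w t v := by
  classical
  obtain ⟨φ₀, hφ₀, hφ₀α⟩ := hfull
  let c0 : Fin 5 := 0
  let μ₁ : Fin 5 → ℂ := fun y => ∑ a, φ₀ a * u 0 (Function.update (Function.update (fun _ => c0) 1 a) 0 y)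
  -- φ₁ : orthogonal to the slice vector at slot 0 and to μ₁, three non-zero coordinates
  obtain ⟨φ₁, hφ₁, hsupp⟩ := LaplaceTriangular.exists_orthogonal_support_three ({α 0, μ₁} : Finset (Fin 5 → ℂ))
    (by have := Finset.card_le_two (a := α 0) (b := μ₁); omega)
  have hφ₁β : ∑ c, φ₁ c * α 0 c = 0 := hφ₁ _ (by simp)
  have hφ₁μ : ∑ c, φ₁ c * μ₁ c = 0 := hφ₁ _ (by simp)
  let μ₂ : Fin 5 → ℂ := fun y => ∑ a, φ₁ a * u 1 (Function.update (Function.update (fun _ => c0) 0 a) 2 y)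
  let N : Fin 5 → Fin 5 → ℂ := fun y z => u 2 (Function.update (Function.update (fun _ => c0) 3 y) 4 z)
  -- the role-ordered fibre-sum matrix as a function of the third covector
  let M : (Fin 5 → ℂ) → Fin 5 → Fin 5 → ℂ := fun φ₂ x y =>
    ∑ σ : Equiv.Perm (Fin 5), if σ 3 = x ∧ σ 4 = y then φ₀ (σ 0) * φ₁ (σ 1) * φ₂ (σ 2) else 0
  have hinj : ∀ φ₂ : Fin 5 → ℂ, (∀ x y, M φ₂ x y = 0) → φ₂ = 0 := by
    intro φ₂ hM
    have hZ := lemmaZ φ₀ φ₁ φ₂ hφ₀ (fun x y _ => hM x y)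
    by_contra hne
    have hψ : ∃ c ∈ (univ : Finset (Fin 5)), φ₂ c ≠ 0 := by
      by_contra h'; push Not at h'; exact hne (funext fun c => by simpa using h' c (mem_univ c))
    obtain ⟨a, -, b, -, hab, hne'⟩ := LaplaceTriangular.offdiag_ne_zero_of_support_three univ φ₁ φ₂
      (by simpa using hsupp) hψ
    exact hne' (hZ a b hab)
  -- two independent candidates orthogonal to the slice vector at slot 2 and to μ₂
  obtain ⟨v₁, hv₁0, hv₁⟩ := LaplaceTriangular.exists_ne_zero_orthogonal ({α 2, μ₂} : Finset (Fin 5 → ℂ))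
    (by have := Finset.card_le_two (a := α 2) (b := μ₂); omega)
  obtain ⟨a₁, ha₁⟩ : ∃ c, v₁ c ≠ 0 := by by_contra h'; push Not at h'; exact hv₁0 (funext h')
  obtain ⟨v₂, hv₂0, hv₂⟩ := LaplaceTriangular.exists_ne_zero_orthogonal
    ({α 2, μ₂, Pi.single a₁ 1} : Finset (Fin 5 → ℂ))
    (by have := Finset.card_le_three (a := α 2) (b := μ₂) (c := (Pi.single a₁ 1 : Fin 5 → ℂ)); omega)
  have hv₂a : v₂ a₁ = 0 := by simpa [Pi.single_apply] using hv₂ (Pi.single a₁ 1) (by simp)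
  have hV : ∀ s' t' : ℂ, (∑ c, (s' * v₁ c + t' * v₂ c) * α 2 c = 0) ∧ (∑ c, (s' * v₁ c + t' * v₂ c) * μ₂ c = 0) := by
    intro s' t'
    have e1 := hv₁ (α 2) (by simp); have e2 := hv₂ (α 2) (by simp)
    have e3 := hv₁ μ₂ (by simp); have e4 := hv₂ μ₂ (by simp)
    constructor
    · calc ∑ c, (s' * v₁ c + t' * v₂ c) * α 2 c = s' * ∑ c, v₁ c * α 2 c + t' * ∑ c, v₂ c * α 2 c := by
            rw [mul_sum, mul_sum, ← sum_add_distrib]; exact sum_congr rfl fun c _ => by ring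
        _ = 0 := by rw [e1, e2]; ring
    · calc ∑ c, (s' * v₁ c + t' * v₂ c) * μ₂ c = s' * ∑ c, v₁ c * μ₂ c + t' * ∑ c, v₂ c * μ₂ c := by
            rw [mul_sum, mul_sum, ← sum_add_distrib]; exact sum_congr rfl fun c _ => by ring
        _ = 0 := by rw [e3, e4]; ring
  have hindep : ∀ s' t' : ℂ, (fun c => s' * v₁ c + t' * v₂ c) = 0 → s' = 0 ∧ t' = 0 := by
    intro s' t' hst
    have h1 := congrFun hst a₁
    simp only [hv₂a, mul_zero, add_zero, Pi.zero_apply] at h1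
    have hs : s' = 0 := (mul_eq_zero.mp h1).resolve_right ha₁
    refine ⟨hs, ?_⟩
    rw [hs] at hst
    by_contra ht
    apply hv₂0; funext c
    have := congrFun hst c
    simp only [zero_mul, zero_add, Pi.zero_apply] at this
    exact (mul_eq_zero.mp this).resolve_left ht
  obtain ⟨φ₂, hφ₂γ, hφ₂μ, hnot⟩ : ∃ φ₂ : Fin 5 → ℂ, (∑ c, φ₂ c * α 2 c = 0) ∧ (∑ c, φ₂ c * μ₂ c = 0) ∧
      ¬ ∃ κ : ℂ, ∀ x y, M φ₂ x y = κ * N x y := by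
    by_contra hall
    push Not at hall
    obtain ⟨κ₁, hκ₁⟩ := hall v₁ (by simpa using (hV 1 0).1) (by simpa using (hV 1 0).2)
    obtain ⟨κ₂, hκ₂⟩ := hall v₂ (by simpa using (hV 0 1).1) (by simpa using (hV 0 1).2)
    have hMw : ∀ x y, M (fun c => (-κ₂) * v₁ c + κ₁ * v₂ c) x y = 0 := by
      intro x y
      have hlin : M (fun c => (-κ₂) * v₁ c + κ₁ * v₂ c) x y = (-κ₂) * M v₁ x y + κ₁ * M v₂ x y :=
        fibre_sum_lin φ₀ φ₁ v₁ v₂ (-κ₂) κ₁ x y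
      rw [hlin, hκ₁ x y, hκ₂ x y]; ring
    have hw0 := hinj (fun c => (-κ₂) * v₁ c + κ₁ * v₂ c) hMw
    obtain ⟨hk2, hk1⟩ := hindep (-κ₂) κ₁ hw0
    have hM1 : ∀ x y, M v₁ x y = 0 := fun x y => by rw [hκ₁ x y, hk1, zero_mul]
    exact hv₁0 (hinj v₁ hM1)
  obtain ⟨φ₃, φ₄, hN0, hM0⟩ : ∃ φ₃ φ₄ : Fin 5 → ℂ, (∑ i, ∑ j, φ₃ i * N i j * φ₄ j) = 0 ∧
      (∑ i, ∑ j, φ₃ i * M φ₂ i j * φ₄ j) ≠ 0 := by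
    by_contra h'
    push Not at h'
    exact hnot (bilinear_proportional (M φ₂) N h')
  -- the witness, slot by slot
  let φ : Fin 5 → Fin 5 → ℂ := ![φ₁, φ₀, φ₂, φ₃, φ₄]
  have hφs0 : φ 0 = φ₁ := rfl
  have hφs1 : φ 1 = φ₀ := rfl
  have hφs2 : φ 2 = φ₂ := rfl
  have hφs3 : φ 3 = φ₃ := rfl
  have hφs4 : φ 4 = φ₄ := rfl
  -- the slot-ordered fibre sums are the role-ordered ones
  let ρ : Equiv.Perm (Fin 5) := ⟨![1, 0, 2, 3, 4], ![1, 0, 2, 3, 4], by decide, by decide⟩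
  have hper : (Matrix.of fun c s => φ s c).permanent ≠ 0 := by
    rw [permanent_two_slot φ, hφs0, hφs1, hφs2, hφs3, hφs4]
    intro h0
    apply hM0
    rw [← h0]
    refine sum_congr rfl fun x _ => sum_congr rfl fun y _ => ?_
    congr 1; congr 1
    rw [fibre_sum_perm3 ρ (by decide) (by decide) (fun a b c => φ₁ a * φ₀ b * φ₂ c) x y]
    refine sum_congr rfl fun σ _ => ?_
    simp only [ρ, Equiv.coe_fn_mk, Matrix.cons_val_zero, Matrix.cons_val_one, Matrix.head_cons,
      Matrix.cons_val_two, Matrix.tail_cons]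
    split_ifs <;> ring
  refine LaplaceFiveSlices.refute_of_kills ![0, 1, 2] α W hW ![0, 0, 3] ![1, 2, 4] (by decide) u w hu hw
    ![false, false, false] ![0, 2, 4] ![1, 0, 3] ![0, 0, 0] ![0, 0, 0] ?_ ?_ φ hper ?_ ?_ ?_
  · intro t ht; fin_cases t
    · left; exact ⟨rfl, rfl⟩
    · right; exact ⟨rfl, rfl⟩
    · right; exact ⟨rfl, rfl⟩
  · intro t ht; fin_cases t
    · exact absurd ht (by decide)
    · exact absurd ht (by decide)
    · exact absurd ht (by decide)
  · intro k; fin_cases k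
    · show ∑ y, φ 0 y * α 0 y = 0
      rw [hφs0]; exact hφ₁β
    · show ∑ y, φ 1 y * α 1 y = 0
      rw [hφs1]; exact hφ₀α
    · show ∑ y, φ 2 y * α 2 y = 0
      rw [hφs2]; exact hφ₂γ
  · intro t ht; fin_cases t
    · show ∑ y, φ 0 y * ∑ a, φ 1 a * u 0 (Function.update (Function.update (fun _ => (0 : Fin 5)) 1 a) 0 y) = 0
      rw [hφs1, hφs0]; exact hφ₁μ
    · show ∑ y, φ 2 y * ∑ a, φ 0 a * u 1 (Function.update (Function.update (fun _ => (0 : Fin 5)) 0 a) 2 y) = 0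
      rw [hφs0, hφs2]; exact hφ₂μ
    · show ∑ y, φ 4 y * ∑ a, φ 3 a * u 2 (Function.update (Function.update (fun _ => (0 : Fin 5)) 3 a) 4 y) = 0
      rw [hφs3, hφs4, ← hN0]
      simp only [N, Fin.sum_univ_five]
      ring
  · intro t ht; fin_cases t
    · exact absurd ht (by decide)
    · exact absurd ht (by decide)
    · exact absurd ht (by decide)

/-- Configuration `(0; 01, 02, 34)`, CASE 1 with the hub at slot `2`. -/
theorem outside_case1_hub2 (α : Fin 3 → Fin 5 → ℂ) (W : Fin 3 → (Fin 5 → Fin 5) → ℂ)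
    (hW : ∀ k, ∀ v v' : Fin 5 → Fin 5, (∀ j, j ≠ (![0, 1, 2] : Fin 3 → Fin 5) k → v j = v' j) → W k v = W k v')
    (u w : Fin 3 → (Fin 5 → Fin 5) → ℂ)
    (hu : ∀ t, ∀ v v' : Fin 5 → Fin 5, v ((![0, 0, 3] : Fin 3 → Fin 5) t) = v' ((![0, 0, 3] : Fin 3 → Fin 5) t) →
      v ((![1, 2, 4] : Fin 3 → Fin 5) t) = v' ((![1, 2, 4] : Fin 3 → Fin 5) t) → u t v = u t v')
    (hw : ∀ t, ∀ v v' : Fin 5 → Fin 5, (∀ j, j ≠ (![0, 0, 3] : Fin 3 → Fin 5) t →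
      j ≠ (![1, 2, 4] : Fin 3 → Fin 5) t → v j = v' j) → w t v = w t v')
    (hfull : ∃ φ₀ : Fin 5 → ℂ, (∀ c, φ₀ c ≠ 0) ∧ ∑ c, φ₀ c * α 2 c = 0) :
    ¬ ∀ v : Fin 5 → Fin 5, (if Function.Injective v then (1 : ℂ) else 0) =
      (∑ k, α k (v ((![0, 1, 2] : Fin 3 → Fin 5) k)) * W k v) + ∑ t, u t v * w t v := by
  classical
  obtain ⟨φ₀, hφ₀, hφ₀α⟩ := hfull
  let c0 : Fin 5 := 0
  let μ₁ : Fin 5 → ℂ := fun y => ∑ a, φ₀ a * u 1 (Function.update (Function.update (fun _ => c0) 2 a) 0 y)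
  -- φ₁ : orthogonal to the slice vector at slot 0 and to μ₁, three non-zero coordinates
  obtain ⟨φ₁, hφ₁, hsupp⟩ := LaplaceTriangular.exists_orthogonal_support_three ({α 0, μ₁} : Finset (Fin 5 → ℂ))
    (by have := Finset.card_le_two (a := α 0) (b := μ₁); omega)
  have hφ₁β : ∑ c, φ₁ c * α 0 c = 0 := hφ₁ _ (by simp)
  have hφ₁μ : ∑ c, φ₁ c * μ₁ c = 0 := hφ₁ _ (by simp)
  let μ₂ : Fin 5 → ℂ := fun y => ∑ a, φ₁ a * u 0 (Function.update (Function.update (fun _ => c0) 0 a) 1 y)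
  let N : Fin 5 → Fin 5 → ℂ := fun y z => u 2 (Function.update (Function.update (fun _ => c0) 3 y) 4 z)
  -- the role-ordered fibre-sum matrix as a function of the third covector
  let M : (Fin 5 → ℂ) → Fin 5 → Fin 5 → ℂ := fun φ₂ x y =>
    ∑ σ : Equiv.Perm (Fin 5), if σ 3 = x ∧ σ 4 = y then φ₀ (σ 0) * φ₁ (σ 1) * φ₂ (σ 2) else 0
  have hinj : ∀ φ₂ : Fin 5 → ℂ, (∀ x y, M φ₂ x y = 0) → φ₂ = 0 := by
    intro φ₂ hM
    have hZ := lemmaZ φ₀ φ₁ φ₂ hφ₀ (fun x y _ => hM x y)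
    by_contra hne
    have hψ : ∃ c ∈ (univ : Finset (Fin 5)), φ₂ c ≠ 0 := by
      by_contra h'; push Not at h'; exact hne (funext fun c => by simpa using h' c (mem_univ c))
    obtain ⟨a, -, b, -, hab, hne'⟩ := LaplaceTriangular.offdiag_ne_zero_of_support_three univ φ₁ φ₂
      (by simpa using hsupp) hψ
    exact hne' (hZ a b hab)
  -- two independent candidates orthogonal to the slice vector at slot 1 and to μ₂
  obtain ⟨v₁, hv₁0, hv₁⟩ := LaplaceTriangular.exists_ne_zero_orthogonal ({α 1, μ₂} : Finset (Fin 5 → ℂ))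
    (by have := Finset.card_le_two (a := α 1) (b := μ₂); omega)
  obtain ⟨a₁, ha₁⟩ : ∃ c, v₁ c ≠ 0 := by by_contra h'; push Not at h'; exact hv₁0 (funext h')
  obtain ⟨v₂, hv₂0, hv₂⟩ := LaplaceTriangular.exists_ne_zero_orthogonal
    ({α 1, μ₂, Pi.single a₁ 1} : Finset (Fin 5 → ℂ))
    (by have := Finset.card_le_three (a := α 1) (b := μ₂) (c := (Pi.single a₁ 1 : Fin 5 → ℂ)); omega)
  have hv₂a : v₂ a₁ = 0 := by simpa [Pi.single_apply] using hv₂ (Pi.single a₁ 1) (by simp)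
  have hV : ∀ s' t' : ℂ, (∑ c, (s' * v₁ c + t' * v₂ c) * α 1 c = 0) ∧ (∑ c, (s' * v₁ c + t' * v₂ c) * μ₂ c = 0) := by
    intro s' t'
    have e1 := hv₁ (α 1) (by simp); have e2 := hv₂ (α 1) (by simp)
    have e3 := hv₁ μ₂ (by simp); have e4 := hv₂ μ₂ (by simp)
    constructor
    · calc ∑ c, (s' * v₁ c + t' * v₂ c) * α 1 c = s' * ∑ c, v₁ c * α 1 c + t' * ∑ c, v₂ c * α 1 c := by
            rw [mul_sum, mul_sum, ← sum_add_distrib]; exact sum_congr rfl fun c _ => by ring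
        _ = 0 := by rw [e1, e2]; ring
    · calc ∑ c, (s' * v₁ c + t' * v₂ c) * μ₂ c = s' * ∑ c, v₁ c * μ₂ c + t' * ∑ c, v₂ c * μ₂ c := by
            rw [mul_sum, mul_sum, ← sum_add_distrib]; exact sum_congr rfl fun c _ => by ring
        _ = 0 := by rw [e3, e4]; ring
  have hindep : ∀ s' t' : ℂ, (fun c => s' * v₁ c + t' * v₂ c) = 0 → s' = 0 ∧ t' = 0 := by
    intro s' t' hst
    have h1 := congrFun hst a₁
    simp only [hv₂a, mul_zero, add_zero, Pi.zero_apply] at h1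
    have hs : s' = 0 := (mul_eq_zero.mp h1).resolve_right ha₁
    refine ⟨hs, ?_⟩
    rw [hs] at hst
    by_contra ht
    apply hv₂0; funext c
    have := congrFun hst c
    simp only [zero_mul, zero_add, Pi.zero_apply] at this
    exact (mul_eq_zero.mp this).resolve_left ht
  obtain ⟨φ₂, hφ₂γ, hφ₂μ, hnot⟩ : ∃ φ₂ : Fin 5 → ℂ, (∑ c, φ₂ c * α 1 c = 0) ∧ (∑ c, φ₂ c * μ₂ c = 0) ∧
      ¬ ∃ κ : ℂ, ∀ x y, M φ₂ x y = κ * N x y := by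
    by_contra hall
    push Not at hall
    obtain ⟨κ₁, hκ₁⟩ := hall v₁ (by simpa using (hV 1 0).1) (by simpa using (hV 1 0).2)
    obtain ⟨κ₂, hκ₂⟩ := hall v₂ (by simpa using (hV 0 1).1) (by simpa using (hV 0 1).2)
    have hMw : ∀ x y, M (fun c => (-κ₂) * v₁ c + κ₁ * v₂ c) x y = 0 := by
      intro x y
      have hlin : M (fun c => (-κ₂) * v₁ c + κ₁ * v₂ c) x y = (-κ₂) * M v₁ x y + κ₁ * M v₂ x y :=
        fibre_sum_lin φ₀ φ₁ v₁ v₂ (-κ₂) κ₁ x y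
      rw [hlin, hκ₁ x y, hκ₂ x y]; ring
    have hw0 := hinj (fun c => (-κ₂) * v₁ c + κ₁ * v₂ c) hMw
    obtain ⟨hk2, hk1⟩ := hindep (-κ₂) κ₁ hw0
    have hM1 : ∀ x y, M v₁ x y = 0 := fun x y => by rw [hκ₁ x y, hk1, zero_mul]
    exact hv₁0 (hinj v₁ hM1)
  obtain ⟨φ₃, φ₄, hN0, hM0⟩ : ∃ φ₃ φ₄ : Fin 5 → ℂ, (∑ i, ∑ j, φ₃ i * N i j * φ₄ j) = 0 ∧
      (∑ i, ∑ j, φ₃ i * M φ₂ i j * φ₄ j) ≠ 0 := by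
    by_contra h'
    push Not at h'
    exact hnot (bilinear_proportional (M φ₂) N h')
  -- the witness, slot by slot
  let φ : Fin 5 → Fin 5 → ℂ := ![φ₁, φ₂, φ₀, φ₃, φ₄]
  have hφs0 : φ 0 = φ₁ := rfl
  have hφs1 : φ 1 = φ₂ := rfl
  have hφs2 : φ 2 = φ₀ := rfl
  have hφs3 : φ 3 = φ₃ := rfl
  have hφs4 : φ 4 = φ₄ := rfl
  -- the slot-ordered fibre sums are the role-ordered ones
  let ρ : Equiv.Perm (Fin 5) := ⟨![1, 2, 0, 3, 4], ![2, 0, 1, 3, 4], by decide, by decide⟩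
  have hper : (Matrix.of fun c s => φ s c).permanent ≠ 0 := by
    rw [permanent_two_slot φ, hφs0, hφs1, hφs2, hφs3, hφs4]
    intro h0
    apply hM0
    rw [← h0]
    refine sum_congr rfl fun x _ => sum_congr rfl fun y _ => ?_
    congr 1; congr 1
    rw [fibre_sum_perm3 ρ (by decide) (by decide) (fun a b c => φ₁ a * φ₂ b * φ₀ c) x y]
    refine sum_congr rfl fun σ _ => ?_
    simp only [ρ, Equiv.coe_fn_mk, Matrix.cons_val_zero, Matrix.cons_val_one, Matrix.head_cons,
      Matrix.cons_val_two, Matrix.tail_cons]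
    split_ifs <;> ring
  refine LaplaceFiveSlices.refute_of_kills ![0, 1, 2] α W hW ![0, 0, 3] ![1, 2, 4] (by decide) u w hu hw
    ![false, false, false] ![1, 0, 4] ![0, 2, 3] ![0, 0, 0] ![0, 0, 0] ?_ ?_ φ hper ?_ ?_ ?_
  · intro t ht; fin_cases t
    · right; exact ⟨rfl, rfl⟩
    · left; exact ⟨rfl, rfl⟩
    · right; exact ⟨rfl, rfl⟩
  · intro t ht; fin_cases t
    · exact absurd ht (by decide)
    · exact absurd ht (by decide)
    · exact absurd ht (by decide)
  · intro k; fin_cases k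
    · show ∑ y, φ 0 y * α 0 y = 0
      rw [hφs0]; exact hφ₁β
    · show ∑ y, φ 1 y * α 1 y = 0
      rw [hφs1]; exact hφ₂γ
    · show ∑ y, φ 2 y * α 2 y = 0
      rw [hφs2]; exact hφ₀α
  · intro t ht; fin_cases t
    · show ∑ y, φ 1 y * ∑ a, φ 0 a * u 0 (Function.update (Function.update (fun _ => (0 : Fin 5)) 0 a) 1 y) = 0
      rw [hφs0, hφs1]; exact hφ₂μ
    · show ∑ y, φ 0 y * ∑ a, φ 2 a * u 1 (Function.update (Function.update (fun _ => (0 : Fin 5)) 2 a) 0 y) = 0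
      rw [hφs2, hφs0]; exact hφ₁μ
    · show ∑ y, φ 4 y * ∑ a, φ 3 a * u 2 (Function.update (Function.update (fun _ => (0 : Fin 5)) 3 a) 4 y) = 0
      rw [hφs3, hφs4, ← hN0]
      simp only [N, Fin.sum_univ_five]
      ring
  · intro t ht; fin_cases t
    · exact absurd ht (by decide)
    · exact absurd ht (by decide)
    · exact absurd ht (by decide)

end LaplaceResidual

end Summit.ValiantsHypothesis.ValiantsHypothesis.Theorems.RigidityForcesSymmetryRankRigidMinimalRepr
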